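import Summits.Ventures.LatticeQCDFlow.Scaling.LumpedStarStepCyclePowers
import Summits.Ventures.LatticeQCDFlow.Scaling.TaggedLumpStep
import Summits.Ventures.LatticeQCDFlow.Scaling.ClockConditionedContraction
import Summits.Ventures.LatticeQCDFlow.Scaling.ResolventPartialSums
import Summits.Ventures.LatticeQCDFlow.Scaling.FiniteOddsDominationLaw

/-!
HONEST FRAMING: exact (Metropolis-corrected) sampling algorithms for lattice gauge theory; figures
of merit are autocorrelation/cost numbers at stated couplings and volumes; no continuum-physics
claim.

# PerAttemptHubLaws — THE `j`-ATTEMPT HUB LAWS OF THE LUMPED STAR'S STEP CHAIN ARE LEGAL PROBABILITY VECTORS WITH THE FORWARD RECURSION; THE TAGGED `j`-ATTEMPT LAWS AND THE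
# RESOLVENT BUILT FROM THE TAIL; THE GENERIC BOUNDS `0 ≤ V_j ≤ 2Φ + 4` ON THE PER-ATTEMPT VALUE OF AN ADJACENT PAIR AND ITS TRANSPOSITION SYMMETRY (lean-2 GEN-44, ours)

Venture-side (OURS).  Cell `lqcd-flow` (pub-lqcd), unit `pub-lqcd-lean-2-g44`, 2026-08-31.  Chapter AD (the instantiation of the C2 ∕ C4 assembly on the lumped star's step objects,
memo MEMO-gen43 §3 (g)), file 1 = the small facts the instantiation consumes.  §1: the hub-law family of chapter AC file 14 (`w_0(N)(h,·) = δ_h`, `w_{j+1}(N)(h,v) =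
Σ_g Kh(N)(h,g)w_j(N)(g,v)`, i.e. `C_j(x,·)` is chapter W's cycle kernel with end-hub law `w_j(comp x)(hub x,·)`) satisfies the FORWARD recursion `w_{j+1}(N)(h,v) = Σ_g w_j(N)(h,g)Kh(N)(g,v)`
(C1's `clock_pow_comm`), is a probability vector in `v` (C1's `clock_pow_rowStochastic` on chapter W file 4's `Kh`), and is LEGAL: from a present hub it charges present contents only
(`starHub_closed`).  §2: the `j`-attempt laws of a stochastic kernel from a point are probability vectors; the geometric resolvent from a point is `(1−σ)δ_z + σ·(tail)` where the tail
solves `x̃ = (1−σ)P(z,·) + σx̃P` (so chapter AC file 9 applies to the tagged chains, whose data are stated through tails).  §3: for a legally supported coupling `q` of two laws on the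
compositions of an adjacent pair (`Δ(N_X,N_Y) = 1`) the per-attempt value `Σ_{α,β}q(α,β)Δ(N_X−δ_α,N_Y−δ_β)(Φ + E − θ_α − θ_β)` lies in `[0, 2Φ+4]` (`θ ∈ [0,1]`, `0 ≤ E ≤ 2`, `Φ + E ≥ 2`:
survivors are at distance `≤ Δ + 1 = 2`), and it is unchanged under transposing the pair and the coupling (the distance is symmetric on equal totals, W23's `cdist_coupling_transpose`
with a symmetric weight).

* `hubLaw_forward`, `hubLaw_nonneg_sum`, `hubLaw_legal`; `pointLaw_nonneg_sum`, `resolvent_of_tail`; `perAttempt_value_nonneg`, `perAttempt_value_le_adjacent`,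
  `perAttempt_value_transpose`.

Literature grade (cell rule): OWN, plumbing; nothing cited; no new bib keys.
-/

open Finset
open Literature.Probability.MarkovChains

namespace Summit.Ventures.LatticeQCDFlow.Scaling

/-! ## §1 The `j`-attempt hub laws -/

section HubLaws
variable {S : Type*} [Fintype S] [DecidableEq S]
variable {W : S → ℝ} {acc : S → S → ℝ} {K : ℕ} {Kh : (S → ℕ) → S → S → ℝ} {w : ℕ → (S → ℕ) → S → S → ℝ}

omit [Fintype S] in
/-- The initial law in the diagonal form C1 uses. [ours] -/
theorem hubLaw_zero' (hw0 : ∀ N h v, w 0 N h v = if v = h then 1 else 0) (N : S → ℕ) (h v : S) :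
    w 0 N h v = if h = v then 1 else 0 := by
  rw [hw0]
  by_cases hhv : h = v
  · subst hhv; simp
  · rw [if_neg hhv, if_neg (Ne.symm hhv)]

/-- **The forward recursion:** `w_{j+1}(N)(h,v) = Σ_g w_j(N)(h,g)·Kh(N)(g,v)`. [ours] -/
theorem hubLaw_forward (hw0 : ∀ N h v, w 0 N h v = if v = h then 1 else 0) (hws : ∀ j N h v, w (j + 1) N h v = ∑ g, Kh N h g * w j N g v)
    (j : ℕ) (N : S → ℕ) (h v : S) : w (j + 1) N h v = ∑ g, w j N h g * Kh N g v :=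
  clock_pow_comm (M := Kh N) (Mn := fun j => w j N) (hubLaw_zero' hw0 N) (fun n h v => hws n N h v) j h v

/-- **The `j`-attempt hub laws are probability vectors** (composition of total `K+1`). [ours] -/
theorem hubLaw_nonneg_sum (hW : ∀ v, 0 < W v) (hacc : ∀ h v, acc h v = min 1 (W h / W v)) (hK : 1 ≤ K)
    (hKoff : ∀ N h v, h ≠ v → Kh N h v = if N h = 0 then 0 else (N v : ℝ) / K * acc h v) (hKdiag : ∀ N h, Kh N h h = 1 - ∑ v ∈ univ.erase h, Kh N h v)
    (hw0 : ∀ N h v, w 0 N h v = if v = h then 1 else 0) (hws : ∀ j N h v, w (j + 1) N h v = ∑ g, Kh N h g * w j N g v)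
    {N : S → ℕ} (hN : ∑ v, N v = K + 1) (j : ℕ) : (∀ h v, 0 ≤ w j N h v) ∧ ∀ h, ∑ v, w j N h v = 1 :=
  clock_pow_rowStochastic (starHub_nonneg hW hacc (hKoff N) (hKdiag N) hK hN) (starHub_rowsum (hKdiag N)) (Mn := fun j => w j N)
    (hubLaw_zero' hw0 N) (fun n h v => hws n N h v) j

omit [Fintype S] in
/-- **Legality:** from a present hub the `j`-attempt law charges present contents only. [ours] -/
theorem hubLaw_legal [Fintype S] (hKoff : ∀ N h v, h ≠ v → Kh N h v = if N h = 0 then 0 else (N v : ℝ) / K * acc h v)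
    (hw0 : ∀ N h v, w 0 N h v = if v = h then 1 else 0) (hws : ∀ j N h v, w (j + 1) N h v = ∑ g, Kh N h g * w j N g v)
    {N : S → ℕ} {h : S} (hh : N h ≠ 0) : ∀ j v, w j N h v ≠ 0 → N v ≠ 0 := by
  intro j
  induction j with
  | zero =>
      intro v hv
      rw [hw0] at hv
      by_cases hvh : v = h
      · rw [hvh]; exact hh
      · rw [if_neg hvh] at hv; exact absurd rfl hv
  | succ j ih =>
      intro v hv hNv
      apply hv
      rw [hubLaw_forward hw0 hws j N h v]
      refine sum_eq_zero fun g _ => ?_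
      by_cases hg : w j N h g = 0
      · rw [hg, zero_mul]
      · rw [starHub_closed (hKoff N) (ih g hg) hNv, mul_zero]

end HubLaws

/-! ## §2 Point laws and the resolvent from the tail -/

section PointLaws
variable {T : Type*} [Fintype T] [DecidableEq T]

/-- **The `j`-attempt laws of a stochastic kernel from a point are probability vectors.** [ours] -/
theorem pointLaw_nonneg_sum {P : T → T → ℝ} (hP0 : ∀ a b, 0 ≤ P a b) (hP1 : ∀ a, ∑ b, P a b = 1)
    {z : T} {x : ℕ → T → ℝ} (hx0 : ∀ v, x 0 v = if v = z then 1 else 0) (hxs : ∀ n v, x (n + 1) v = ∑ h, x n h * P h v) (n : ℕ) :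
    (∀ v, 0 ≤ x n v) ∧ ∑ v, x n v = 1 := by
  induction n with
  | zero =>
      refine ⟨fun v => by rw [hx0]; split_ifs <;> norm_num, ?_⟩
      simp_rw [hx0]; rw [Finset.sum_ite_eq' univ z]; simp
  | succ n ih =>
      refine ⟨fun v => by rw [hxs]; exact sum_nonneg fun h _ => mul_nonneg (ih.1 h) (hP0 h v), ?_⟩
      simp_rw [hxs]; rw [sum_comm]
      calc ∑ h, ∑ v, x n h * P h v = ∑ h, x n h := sum_congr rfl fun h _ => by rw [← mul_sum, hP1, mul_one]
        _ = 1 := ih.2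

/-- **The resolvent from the tail:** if `x̃ = (1−σ)P(z,·) + σx̃P` then `u = (1−σ)δ_z + σx̃` solves `u = (1−σ)δ_z + σuP`. [ours] -/
theorem resolvent_of_tail {P : T → T → ℝ} {σ : ℝ} {z : T} {xt u : T → ℝ}
    (hxt : ∀ t, xt t = (1 - σ) * P z t + σ * ∑ t', xt t' * P t' t) (hu : ∀ t, u t = (1 - σ) * (if t = z then 1 else 0) + σ * xt t) :
    ∀ t, u t = (1 - σ) * (if t = z then 1 else 0) + σ * ∑ t', u t' * P t' t := by
  intro t
  have e : ∑ t', u t' * P t' t = xt t := by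
    have h1 : ∀ t', u t' * P t' t = (1 - σ) * ((if t' = z then 1 else 0) * P t' t) + σ * (xt t' * P t' t) := fun t' => by rw [hu]; ring
    rw [sum_congr rfl fun t' _ => h1 t', sum_add_distrib, ← mul_sum, ← mul_sum]
    have hδ : ∑ t', (if t' = z then (1 : ℝ) else 0) * P t' t = P z t := by
      rw [show (∑ t', (if t' = z then (1 : ℝ) else 0) * P t' t) = ∑ t', (if t' = z then P t' t else 0) from
        sum_congr rfl fun t' _ => by split_ifs <;> simp, Finset.sum_ite_eq' univ z]
      simp
    rw [hδ]; exact (hxt t).symm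
  rw [e]; exact hu t

end PointLaws

/-! ## §3 The per-attempt value of an adjacent pair: generic bounds and transposition -/

section Value
variable {S : Type*} [Fintype S] [DecidableEq S]
variable {Δ : (S → ℕ) → (S → ℕ) → ℕ} {NX NY : S → ℕ} {qt : S → S → ℝ} {θ : S → ℝ} {Φ E : ℝ}

omit [Fintype S] in
/-- **`V ≥ 0`** (`θ ≤ 1`, `Φ + E ≥ 2`, `q ≥ 0`). [ours] -/
theorem perAttempt_value_nonneg [Fintype S] (hq0 : ∀ a b, 0 ≤ qt a b) (hθ1 : ∀ v, θ v ≤ 1) (hΦE : 2 ≤ Φ + E) :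
    0 ≤ ∑ a, ∑ b, qt a b * ((Δ (NX - Pi.single a 1) (NY - Pi.single b 1) : ℝ) * (Φ + E - θ a - θ b)) :=
  sum_nonneg fun a _ => sum_nonneg fun b _ =>
    mul_nonneg (hq0 a b) (mul_nonneg (Nat.cast_nonneg _) (by linarith [hθ1 a, hθ1 b]))

/-- **`V ≤ 2Φ + 4` on an adjacent pair** (`Δ(N_X,N_Y) = 1`, legal support: survivors at distance `≤ 2`; `θ ≥ 0`, `E ≤ 2`, `Φ ≥ 0`). [ours] -/
theorem perAttempt_value_le_adjacent (hΔ : ∀ N N', Δ N N' = ∑ v, (N v - N' v)) (hD1 : Δ NX NY = 1)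
    (hq0 : ∀ a b, 0 ≤ qt a b) (hq1 : ∑ a, ∑ b, qt a b = 1) (hleg : ∀ a b, qt a b ≠ 0 → NX a ≠ 0 ∧ NY b ≠ 0)
    (hθ0 : ∀ v, 0 ≤ θ v) (hΦ : 0 ≤ Φ) (hE : E ≤ 2) :
    ∑ a, ∑ b, qt a b * ((Δ (NX - Pi.single a 1) (NY - Pi.single b 1) : ℝ) * (Φ + E - θ a - θ b)) ≤ 2 * Φ + 4 := by
  have hterm : ∀ a b, qt a b * ((Δ (NX - Pi.single a 1) (NY - Pi.single b 1) : ℝ) * (Φ + E - θ a - θ b)) ≤ qt a b * (2 * Φ + 4) := by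
    intro a b
    by_cases hq : qt a b = 0
    · rw [hq]; simp
    · obtain ⟨ha, hb⟩ := hleg a b hq
      have hD : (Δ (NX - Pi.single a 1) (NY - Pi.single b 1) : ℝ) ≤ 2 := by
        have h := cdist_survivors_le_add_one hΔ (NX - Pi.single a 1) (NY - Pi.single b 1) a b
        rw [← urnChain_survivor NX ha, ← urnChain_survivor NY hb, hD1] at h
        exact_mod_cast h
      have hD0 : (0 : ℝ) ≤ (Δ (NX - Pi.single a 1) (NY - Pi.single b 1) : ℝ) := Nat.cast_nonneg _
      refine mul_le_mul_of_nonneg_left ?_ (hq0 a b)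
      set D' : ℝ := (Δ (NX - Pi.single a 1) (NY - Pi.single b 1) : ℝ) with hD'
      by_cases hf : 0 ≤ Φ + E - θ a - θ b
      · calc D' * (Φ + E - θ a - θ b) ≤ 2 * (Φ + 2) := mul_le_mul hD (by linarith [hθ0 a, hθ0 b]) hf (by norm_num)
          _ = 2 * Φ + 4 := by ring
      · have : D' * (Φ + E - θ a - θ b) ≤ 0 := mul_nonpos_of_nonneg_of_nonpos hD0 (le_of_lt (not_le.mp hf))
        linarith
  calc _ ≤ ∑ a, ∑ b, qt a b * (2 * Φ + 4) := sum_le_sum fun a _ => sum_le_sum fun b _ => hterm a b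
    _ = (∑ a, ∑ b, qt a b) * (2 * Φ + 4) := by rw [sum_mul]; exact sum_congr rfl fun a _ => by rw [sum_mul]
    _ = 2 * Φ + 4 := by rw [hq1, one_mul]

/-- **Transposition symmetry:** transposing the pair and the (legally supported) coupling leaves the value unchanged, for any symmetric weight `g`. [ours] -/
theorem perAttempt_value_transpose (hΔ : ∀ N N', Δ N N' = ∑ v, (N v - N' v)) {K : ℕ} (hX : ∑ v, NX v = K + 1) (hY : ∑ v, NY v = K + 1)
    (hleg : ∀ a b, qt a b ≠ 0 → NX a ≠ 0 ∧ NY b ≠ 0) (g : S → S → ℝ) (hg : ∀ a b, g a b = g b a) :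
    ∑ a, ∑ b, qt b a * ((Δ (NY - Pi.single a 1) (NX - Pi.single b 1) : ℝ) * g a b)
      = ∑ a, ∑ b, qt a b * ((Δ (NX - Pi.single a 1) (NY - Pi.single b 1) : ℝ) * g a b) := by
  rw [sum_comm]
  refine sum_congr rfl fun a _ => sum_congr rfl fun b _ => ?_
  by_cases h : qt a b = 0
  · rw [h]; simp
  · obtain ⟨ha, hb⟩ := hleg a b h
    rw [cdist_symm_of_sum_eq hΔ (by rw [survivor_sum hY hb, survivor_sum hX ha]), hg b a]

end Value

end Summit.Ventures.LatticeQCDFlow.Scaling
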